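import Summits.CriticalPhenomena.PercolationContinuityZ3.Theorems.PercNearOneGluingNoHeavyLowerTailSunflowerMultiPetalHomeRouting
import Summits.CriticalPhenomena.PercolationContinuityZ3.Theorems.PercNearOneGluingNoHeavyLowerTailSunflowerMultiPetalSlackMonotone
import HarnessLib
import HarnessLib.Audit

/-!
# `NoHeavyLowerTail` (crux stmt-CriticalPhenomena-4575), abstract sunflower cubic, `k` petals: the SLOT FORM OF THE FLIP CONJECTURE (G) —
# `ZKflip D = 3·SwKflip [decided] D − NtriKflip D`, the flipped spectator supply is a sum of OFFSET cube slacks `pslack Kᶜ (D ∩ K) ≥ 0`,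
# and Conjecture G holds in the rainbow-free class (in particular for `k ≤ 2` petals) for EVERY flip set `D`

Support file (seat `prim-l12-p2` gen 32; `--supports stmt-CriticalPhenomena-4575`; companion of `…SunflowerMultiPetalHomeRouting` (p359567: `ZKflip`,
`@[conjecture] FlipPartitionLemmaK` = Conjecture G), `…SunflowerMultiPetalSpectator` (p339016: `s6K_eq_spec`, `decK`, `kkK`, `triK`) and
`…SunflowerMultiPetalSlackMonotone` (p363882: `pslack`, `pslack_nonneg`)).  Everything here is PROVED (no `sorry`, no named fact, no new conjecture).
Memo: run/shared/lean/prim/prim-l12/prim-l12-p2/FINDING-g32.md §2.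

WHY.  Conjecture G (`0 ≤ ZKflip D` for every flip set `D`; census-clean, exhaustive on ≤ 6 points) is the flip-invariant / coefficientwise form of ★ₖ and the
form that COMPOSITION needs (the partition functional of a gadget composition expands over flipped coefficients of the quotient, p360158).  Its spectator
analysis was missing.  Here:
* `MSunflower.SwKflip w D`, `MSunflower.NtriKflip D` — flipped spectator sum / flipped rainbow count;  `ZKflip_eq_spec : ZKflip D = 3·SwKflip (decK k) D − NtriKflip D`.
* **`SwKflip_eq_sum_pslack`**: `SwKflip w D = Σ_K w (lab (K ∆ D)) · pslack Kᶜ (D ∩ K)` — after the flip, the two blocks complementary to the spectator block `K` are again an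
  ANTIPODAL PAIR of the cube `2^{Kᶜ}`, read with the COMMON OFFSET `D ∩ K`; so every flipped supply is an offset cube slack, `≥ 0` by `pslack_nonneg`
  (antipodal Gladkov with equal offsets).  Hence `SwKflip_nonneg`, `ZKflip_add_NtriKflip_nonneg` (the flipped rainbow count is the ONLY negative term of G),
  **`ZKflip_nonneg_of_NtriKflip_eq_zero`** and **`ZKflip_nonneg_of_le_two`**: Conjecture G holds for every structure with at most two petals and every `D`
  (new; the `D = ∅` case is p339016's `ZK_nonneg_of_le_two`).  So G, like ★ₖ, reads "flipped rainbows ≤ 3 × total offset slack of the flipped-decided spectators".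
-/

namespace Summit.CriticalPhenomena.PercolationContinuityZ3.Theorems.SunflowerPartition

open Finset

variable {α : Type*} [DecidableEq α]

/-! ## Two set identities: flipping an antipodal pair of the cube `2^W` by `D` gives an antipodal pair of `2^W` with the common offset `D ∖ W` -/

/-- For `T ⊆ W`: `T ∆ D = (D ∖ W) ∪ (T ∆ (D ∩ W))`. [this work] -/
theorem symmDiff_eq_offset_union {T W : Finset α} (D : Finset α) (hT : T ⊆ W) :
    symmDiff T D = (D \ W) ∪ symmDiff T (D ∩ W) := by
  ext x
  have hx : x ∈ T → x ∈ W := fun h => hT h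
  simp only [mem_symmDiff, mem_union, mem_sdiff, mem_inter]
  tauto

/-- For `T ⊆ W`: `(W ∖ T) ∆ D = (D ∖ W) ∪ (W ∖ (T ∆ (D ∩ W)))`. [this work] -/
theorem sdiff_symmDiff_eq_offset_union {T W : Finset α} (D : Finset α) (hT : T ⊆ W) :
    symmDiff (W \ T) D = (D \ W) ∪ (W \ symmDiff T (D ∩ W)) := by
  ext x
  have hx : x ∈ T → x ∈ W := fun h => hT h
  simp only [mem_symmDiff, mem_union, mem_sdiff, mem_inter]
  tauto

namespace MSunflower

variable [Fintype α] {k : ℕ} (F : MSunflower k α)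

/-! ## Flipped spectator sum and flipped rainbow count -/

/-- The FLIPPED spectator sum with weight `w`: `Σ_{(P¹,P²,P³)} w (lab (P¹ ∆ D)) · kkK (lab (P² ∆ D)) (lab (P³ ∆ D))`. [this work] -/
def SwKflip (w : Fin (k + 2) → ℤ) (D : Finset α) : ℤ :=
  ∑ q ∈ parts α, w (F.lab (symmDiff q.1 D)) * kkK k (F.lab (symmDiff q.2 D)) (F.lab (symmDiff (q.1 ∪ q.2)ᶜ D))

/-- The FLIPPED rainbow count `Σ triK` over the flipped blocks. [this work] -/
def NtriKflip (D : Finset α) : ℤ :=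
  ∑ q ∈ parts α, triK k (F.lab (symmDiff q.1 D)) (F.lab (symmDiff q.2 D)) (F.lab (symmDiff (q.1 ∪ q.2)ᶜ D))

/-- `NtriKflip D ≥ 0`. [this work] -/
theorem NtriKflip_nonneg (D : Finset α) : 0 ≤ F.NtriKflip D := by
  unfold NtriKflip; exact sum_nonneg fun q _ => triK_nonneg _ _ _ _

/-- **Flipped spectator form**: `ZKflip D = 3·SwKflip [decided] D − NtriKflip D` (the pointwise `s6K_eq_spec` and the block symmetries of `parts`). [this work] -/
theorem ZKflip_eq_spec (D : Finset α) : F.ZKflip D = 3 * F.SwKflip (decK k) D - F.NtriKflip D := by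
  unfold ZKflip SwKflip NtriKflip
  have h2 : ∑ q ∈ parts α, decK k (F.lab (symmDiff q.2 D)) * kkK k (F.lab (symmDiff q.1 D)) (F.lab (symmDiff (q.1 ∪ q.2)ᶜ D)) =
      ∑ q ∈ parts α, decK k (F.lab (symmDiff q.1 D)) * kkK k (F.lab (symmDiff q.2 D)) (F.lab (symmDiff (q.1 ∪ q.2)ᶜ D)) :=
    sum_parts_swap12 (fun A B C => decK k (F.lab (symmDiff B D)) * kkK k (F.lab (symmDiff A D)) (F.lab (symmDiff C D)))
  have h3 : ∑ q ∈ parts α, decK k (F.lab (symmDiff (q.1 ∪ q.2)ᶜ D)) * kkK k (F.lab (symmDiff q.1 D)) (F.lab (symmDiff q.2 D)) =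
      ∑ q ∈ parts α, decK k (F.lab (symmDiff q.1 D)) * kkK k (F.lab (symmDiff q.2 D)) (F.lab (symmDiff (q.1 ∪ q.2)ᶜ D)) := by
    rw [show (∑ q ∈ parts α, decK k (F.lab (symmDiff (q.1 ∪ q.2)ᶜ D)) * kkK k (F.lab (symmDiff q.1 D)) (F.lab (symmDiff q.2 D))) =
        ∑ q ∈ parts α, decK k (F.lab (symmDiff q.1 D)) * kkK k (F.lab (symmDiff (q.1 ∪ q.2)ᶜ D)) (F.lab (symmDiff q.2 D)) from
      sum_parts_swap13 (fun A B C => decK k (F.lab (symmDiff C D)) * kkK k (F.lab (symmDiff A D)) (F.lab (symmDiff B D)))]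
    exact sum_congr rfl fun q _ => by rw [kkK_comm k (F.lab (symmDiff (q.1 ∪ q.2)ᶜ D)) (F.lab (symmDiff q.2 D))]
  rw [show (∑ q ∈ parts α, s6K k (F.lab (symmDiff q.1 D)) (F.lab (symmDiff q.2 D)) (F.lab (symmDiff (q.1 ∪ q.2)ᶜ D))) =
      ∑ q ∈ parts α, (decK k (F.lab (symmDiff q.1 D)) * kkK k (F.lab (symmDiff q.2 D)) (F.lab (symmDiff (q.1 ∪ q.2)ᶜ D))
        + decK k (F.lab (symmDiff q.2 D)) * kkK k (F.lab (symmDiff q.1 D)) (F.lab (symmDiff (q.1 ∪ q.2)ᶜ D))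
        + decK k (F.lab (symmDiff (q.1 ∪ q.2)ᶜ D)) * kkK k (F.lab (symmDiff q.1 D)) (F.lab (symmDiff q.2 D))
        - triK k (F.lab (symmDiff q.1 D)) (F.lab (symmDiff q.2 D)) (F.lab (symmDiff (q.1 ∪ q.2)ᶜ D))) from
    sum_congr rfl fun q _ => s6K_eq_spec k _ _ _]
  rw [sum_sub_distrib, sum_add_distrib, sum_add_distrib, h2, h3]
  ring

/-- **The flipped supply at a spectator is an OFFSET cube slack**: `SwKflip w D = Σ_K w (lab (K ∆ D)) · pslack Kᶜ (D ∩ K)` — the flips of the two blocks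
complementary to `K` form an antipodal pair of the cube `2^{Kᶜ}` carrying the common offset `D ∩ K`. [this work] -/
theorem SwKflip_eq_sum_pslack (w : Fin (k + 2) → ℤ) (D : Finset α) :
    F.SwKflip w D = ∑ K : Finset α, w (F.lab (symmDiff K D)) * F.pslack Kᶜ (D ∩ K) := by
  unfold SwKflip
  rw [Sunflower.sum_parts_eq (f := fun S T => w (F.lab (symmDiff S D)) * kkK k (F.lab (symmDiff T D)) (F.lab (symmDiff (S ∪ T)ᶜ D)))]
  refine sum_congr rfl fun K _ => ?_
  rw [← mul_sum]
  congr 1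
  unfold pslack
  have hDK : D \ Kᶜ = D ∩ K := by
    ext x; simp only [mem_sdiff, mem_compl, not_not, mem_inter]
  -- rewrite every summand as an antipodal pair of `Kᶜ` with offset `D ∩ K`, flipped inside by `D ∩ Kᶜ`
  have hterm : ∀ T ∈ (Kᶜ).powerset,
      kkK k (F.lab (symmDiff T D)) (F.lab (symmDiff (K ∪ T)ᶜ D))
        = kkK k (F.lab ((D ∩ K) ∪ symmDiff T (D ∩ Kᶜ))) (F.lab ((D ∩ K) ∪ (Kᶜ \ symmDiff T (D ∩ Kᶜ)))) := by
    intro T hT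
    have hTK : T ⊆ Kᶜ := mem_powerset.1 hT
    have hc : (K ∪ T)ᶜ = Kᶜ \ T := by rw [compl_union, sdiff_eq_inter_compl]
    rw [hc, symmDiff_eq_offset_union D hTK, sdiff_symmDiff_eq_offset_union D hTK, hDK]
  rw [sum_congr rfl hterm]
  -- reindex by the involution `T ↦ T ∆ (D ∩ Kᶜ)` of the subsets of `Kᶜ`
  refine sum_nbij' (fun T => symmDiff T (D ∩ Kᶜ)) (fun T => symmDiff T (D ∩ Kᶜ)) ?_ ?_ ?_ ?_ ?_
  · intro T hT
    have hTK : T ⊆ Kᶜ := mem_powerset.1 hT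
    exact mem_powerset.2 (symmDiff_subset_union.trans (union_subset hTK inter_subset_right))
  · intro T hT
    have hTK : T ⊆ Kᶜ := mem_powerset.1 hT
    exact mem_powerset.2 (symmDiff_subset_union.trans (union_subset hTK inter_subset_right))
  · intro T _; exact symmDiff_symmDiff_cancel_right _ _
  · intro T _; exact symmDiff_symmDiff_cancel_right _ _
  · intro T _; rfl

/-- Flipped spectator sums with nonnegative weights are nonnegative (offset antipodal Gladkov, cube by cube). [this work] -/
theorem SwKflip_nonneg (w : Fin (k + 2) → ℤ) (hw : ∀ v, 0 ≤ w v) (D : Finset α) : 0 ≤ F.SwKflip w D := by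
  rw [F.SwKflip_eq_sum_pslack]
  exact sum_nonneg fun K _ => mul_nonneg (hw _) (F.pslack_nonneg _ _)

/-- `ZKflip D + NtriKflip D ≥ 0`: the flipped rainbow count is the only negative term of Conjecture G. [this work] -/
theorem ZKflip_add_NtriKflip_nonneg (D : Finset α) : 0 ≤ F.ZKflip D + F.NtriKflip D := by
  rw [F.ZKflip_eq_spec]
  have := F.SwKflip_nonneg (decK k) (fun v => by unfold decK; split_ifs <;> norm_num) D
  linarith

/-- **Conjecture G in the flipped-rainbow-free class**: `NtriKflip D = 0 ⟹ 0 ≤ ZKflip D`. [this work] -/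
theorem ZKflip_nonneg_of_NtriKflip_eq_zero {D : Finset α} (h : F.NtriKflip D = 0) : 0 ≤ F.ZKflip D := by
  have := F.ZKflip_add_NtriKflip_nonneg D; linarith

/-- **Conjecture G holds for `k ≤ 2` petals, for EVERY flip set `D`** (no flipped rainbow can exist). [this work] -/
theorem ZKflip_nonneg_of_le_two (hk : k ≤ 2) (D : Finset α) : 0 ≤ F.ZKflip D := by
  refine F.ZKflip_nonneg_of_NtriKflip_eq_zero ?_
  unfold NtriKflip
  exact sum_eq_zero fun q _ => triK_eq_zero_of_le_two hk _ _ _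

/-- The G-analogue of "★ₖ ⟺ rainbows ≤ 3 × decided slack": `0 ≤ ZKflip D ↔ NtriKflip D ≤ 3·SwKflip (decK k) D`. [this work] -/
theorem ZKflip_nonneg_iff (D : Finset α) : 0 ≤ F.ZKflip D ↔ F.NtriKflip D ≤ 3 * F.SwKflip (decK k) D := by
  rw [F.ZKflip_eq_spec]; constructor <;> intro h <;> linarith

end MSunflower

end Summit.CriticalPhenomena.PercolationContinuityZ3.Theorems.SunflowerPartition
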